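import Mathlib.Analysis.Complex.UpperHalfPlane.Topology
import Mathlib.Analysis.Convex.PathConnected
import Mathlib.Topology.MetricSpace.Thickening
import Literature.Topology.PlaneTopology.EilenbergCriterion
import HarnessLib

/-!
# An arc of the closed upper half-plane hanging from the real line does not separate `ℍ`

Topic: Topology / PlaneTopology. From the separation theorem for Jordan arcs
(`Literature.Topology.PlaneTopology.JordanArcSeparation`, McCleary (2006), Ch. 9 p. 130, PROVED in the tree as
`Literature.Topology.PlaneTopology.JordanArcSeparation_holds`, file `EilenbergCriterion`) and Janiszewski's theorem
(`Literature.Topology.PlaneTopology.janiszewski`, file `Janiszewski`) we prove: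

* `Literature.Topology.PlaneTopology.isConnected_upperHalfPlaneSet_diff_arc` — if `Λ ⊆ ℂ` is a Jordan arc (a set
  homeomorphic to `[0, 1]`) whose initial point is real and all of whose other points lie in
  the open upper half-plane `ℍ`, then `ℍ ∖ Λ` is (open and) connected;
* `Literature.Topology.PlaneTopology.isConnected_upperHalfPlaneSet_diff_image` — the form used for Loewner chains: for an
  injective continuous `γ : ℝ≥0 → ℂ` with `γ 0` real and `γ t ∈ ℍ` for `t > 0` (a simple trace,
  `Literature.Probability.RandomPlanarGeometry.Loewner.IsSimpleTrace`), every `ℍ ∖ γ[0, t]` is connected. Consequently the Loewner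
  hull generated by a simple curve is the curve itself, `K_t = γ(0, t]` (the complement of the
  unbounded component of the connected unbounded set `ℍ ∖ γ[0, t]`; drawn in
  `Literature/Probability/RandomPlanarGeometry`).

Proof. Let `Λ* = conj(Λ)` be the mirror arc; `Λ ∩ Λ* = {γ(0)}` is a point. Neither `Λ` nor
`Λ*` separates the plane (arc theorem), so by Janiszewski two points `x, y ∈ ℍ ∖ Λ` lie in one
component of the open set `ℂ ∖ (Λ ∪ Λ*)`, hence are joined by a path `p` avoiding `Λ ∪ Λ*`.
Fold it into the closed upper half-plane, `p̃ = Re p + i |Im p|`: since `Λ ∪ Λ*` is symmetric,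
`p̃` still avoids `Λ`, so it stays at distance `≥ δ > 0` from the compact `Λ`; then
`p̃ + iη` (`η < δ` small) is a path in `ℍ ∖ Λ` from `x + iη` to `y + iη`, and the vertical
segments `[x, x + iη]`, `[y, y + iη]` lie in the open set `ℍ ∖ Λ` for `η` small.

Mathlib: `IsOpen.isConnected_iff_isPathConnected` (the plane is locally path connected),
`JoinedIn`, `IsCompact.exists_thickening_subset_open`, `Continuous.homeoOfEquivCompactToT2`.

## References
* J. McCleary, *A First Course in Topology*, AMS (2006), Ch. 9, p. 130. [Mccleary2006]
* Ch. Pommerenke, *Boundary Behaviour of Conformal Maps*, Springer (1992), §1.1 (Janiszewski). [PommerenkeBBCM1992]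
-/

noncomputable section

open Set Topology Filter Metric Complex
open UpperHalfPlane (upperHalfPlaneSet isOpen_upperHalfPlaneSet)
open scoped NNReal

namespace Literature.Topology.PlaneTopology

/-! ### Folding the plane onto the closed upper half-plane -/

/-- The fold `z ↦ Re z + i |Im z|` of the plane onto the closed upper half-plane. [folklore] -/
def foldUp (z : ℂ) : ℂ := (z.re : ℂ) + (|z.im| : ℝ) * I

/-- The fold is continuous. [folklore] -/
theorem continuous_foldUp : Continuous foldUp := by
  unfold foldUp
  fun_prop

/-- Real part of the fold. [folklore] -/
@[simp] theorem foldUp_re (z : ℂ) : (foldUp z).re = z.re := by simp [foldUp]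

/-- Imaginary part of the fold. [folklore] -/
@[simp] theorem foldUp_im (z : ℂ) : (foldUp z).im = |z.im| := by simp [foldUp]

/-- On the closed upper half-plane the fold is the identity. [folklore] -/
theorem foldUp_of_nonneg {z : ℂ} (hz : 0 ≤ z.im) : foldUp z = z :=
  Complex.ext (by simp) (by simp [abs_of_nonneg hz])

/-- On the lower half-plane the fold is complex conjugation. [folklore] -/
theorem foldUp_of_neg {z : ℂ} (hz : z.im < 0) : foldUp z = (starRingEnd ℂ) z :=
  Complex.ext (by simp) (by simp [abs_of_neg hz])

/-- The fold of a point is the point or its conjugate. [folklore] -/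
theorem foldUp_eq_or (z : ℂ) : foldUp z = z ∨ foldUp z = (starRingEnd ℂ) z := by
  rcases le_or_gt 0 z.im with h | h
  · exact Or.inl (foldUp_of_nonneg h)
  · exact Or.inr (foldUp_of_neg h)

/-! ### The mirror arc -/

section Arc

variable {Λ : Set ℂ}

/-- The mirror image `conj(Λ)` of a Jordan arc is a Jordan arc. [folklore] -/
def mirrorHomeomorph (e : unitInterval ≃ₜ Λ) : unitInterval ≃ₜ ((starRingEnd ℂ) '' Λ) :=
  e.trans (conjCLE.toHomeomorph.image Λ)

/-- Points of an arc hanging in the closed upper half-plane have nonnegative imaginary part.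
[folklore] -/
theorem im_nonneg_of_mem_arc (e : unitInterval ≃ₜ Λ) (h0 : ((e 0 : Λ) : ℂ).im = 0)
    (hpos : ∀ s : unitInterval, s ≠ 0 → 0 < ((e s : Λ) : ℂ).im) {z : ℂ} (hz : z ∈ Λ) :
    0 ≤ z.im := by
  obtain ⟨s, hs⟩ : ∃ s : unitInterval, ((e s : Λ) : ℂ) = z := ⟨e.symm ⟨z, hz⟩, by simp⟩
  rcases eq_or_ne s 0 with rfl | hs0
  · rw [← hs, h0]
  · rw [← hs]
    exact (hpos s hs0).le

/-- An arc hanging in the closed upper half-plane from a real point meets its mirror image only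
at that point. [folklore] -/
theorem inter_mirror_subset (e : unitInterval ≃ₜ Λ) (h0 : ((e 0 : Λ) : ℂ).im = 0)
    (hpos : ∀ s : unitInterval, s ≠ 0 → 0 < ((e s : Λ) : ℂ).im) :
    Λ ∩ (starRingEnd ℂ) '' Λ ⊆ {((e 0 : Λ) : ℂ)} := by
  rintro z ⟨hz, ⟨w, hw, rfl⟩⟩
  have h1 : 0 ≤ ((starRingEnd ℂ) w).im := im_nonneg_of_mem_arc e h0 hpos hz
  have h2 : 0 ≤ w.im := im_nonneg_of_mem_arc e h0 hpos hw
  rw [Complex.conj_im] at h1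
  have hw0 : w.im = 0 := le_antisymm (by linarith) h2
  -- `w = e s` with `Im = 0` forces `s = 0`
  obtain ⟨s, hs⟩ : ∃ s : unitInterval, ((e s : Λ) : ℂ) = w := ⟨e.symm ⟨w, hw⟩, by simp⟩
  have hs0 : s = 0 := by
    by_contra hs0
    have := hpos s hs0
    rw [hs, hw0] at this
    exact lt_irrefl _ this
  subst hs0
  rw [mem_singleton_iff, ← hs]
  exact Complex.ext (by simp) (by simp [hs ▸ hw0])

/-- **A Jordan arc of the closed upper half-plane hanging from a real point does not separate
the open upper half-plane**: if `Λ ≅ [0, 1]` has `e 0 ∈ ℝ` and `e s ∈ ℍ` for `s ≠ 0`, then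
`ℍ ∖ Λ` is connected. From the arc separation theorem (McCleary 2006, Ch. 9 p. 130) for `Λ` and
its mirror image and Janiszewski's theorem (Pommerenke 1992, §1.1), by folding a connecting
path into the upper half-plane and lifting it off the real line. [folklore] -/
theorem isConnected_upperHalfPlaneSet_diff_arc (e : unitInterval ≃ₜ Λ) (h0 : ((e 0 : Λ) : ℂ).im = 0)
    (hpos : ∀ s : unitInterval, s ≠ 0 → 0 < ((e s : Λ) : ℂ).im) :
    IsConnected (upperHalfPlaneSet \ Λ) := by
  classical
  set Λ' : Set ℂ := (starRingEnd ℂ) '' Λ with hΛ'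
  have hΛc : IsCompact Λ := isCompact_of_homeomorph_unitInterval e
  have hΛ'c : IsCompact Λ' := isCompact_of_homeomorph_unitInterval (mirrorHomeomorph e)
  have hΛconn : IsConnected Λᶜ := JordanArcSeparation_holds Λ ⟨e⟩
  have hΛ'conn : IsConnected Λ'ᶜ := JordanArcSeparation_holds Λ' ⟨mirrorHomeomorph e⟩
  have hinter : IsPreconnected (Λ ∩ Λ') :=
    (subsingleton_singleton.anti (inter_mirror_subset e h0 hpos)).isPreconnected
  have hΛ'im : ∀ z ∈ Λ', z.im ≤ 0 := by
    rintro _ ⟨w, hw, rfl⟩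
    rw [Complex.conj_im, neg_nonpos]
    exact im_nonneg_of_mem_arc e h0 hpos hw
  -- the set `M = ℍ ∖ Λ` is open
  set M : Set ℂ := upperHalfPlaneSet \ Λ with hM
  have hMopen : IsOpen M := isOpen_upperHalfPlaneSet.sdiff hΛc.isClosed
  -- two points of `M` are joined in `M`
  have hjoin : ∀ x ∈ M, ∀ y ∈ M, JoinedIn M x y := by
    intro x hx y hy
    have hxim : 0 < x.im := hx.1
    have hyim : 0 < y.im := hy.1
    have hxΛ' : x ∈ Λ'ᶜ := fun h ↦ (hΛ'im x h).not_gt hxim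
    have hyΛ' : y ∈ Λ'ᶜ := fun h ↦ (hΛ'im y h).not_gt hyim
    -- Janiszewski: `y` is in the component of `x` in `ℂ ∖ (Λ ∪ Λ')`
    have hyA : y ∈ connectedComponentIn Λᶜ x :=
      hΛconn.isPreconnected.subset_connectedComponentIn hx.2 Subset.rfl hy.2
    have hyB : y ∈ connectedComponentIn Λ'ᶜ x :=
      hΛ'conn.isPreconnected.subset_connectedComponentIn hxΛ' Subset.rfl hyΛ'
    have hyC := janiszewski hΛc hΛ'c hinter hyA hyB
    set O : Set ℂ := (Λ ∪ Λ')ᶜ with hO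
    have hOopen : IsOpen O := (hΛc.union hΛ'c).isClosed.isOpen_compl
    have hxO : x ∈ O := fun h ↦ h.elim hx.2 hxΛ'
    have hCopen : IsOpen (connectedComponentIn O x) := hOopen.connectedComponentIn
    have hCpath : IsPathConnected (connectedComponentIn O x) :=
      hCopen.isConnected_iff_isPathConnected.1
        ⟨⟨x, mem_connectedComponentIn hxO⟩, isPreconnected_connectedComponentIn⟩
    obtain ⟨p, hp⟩ := hCpath.joinedIn x (mem_connectedComponentIn hxO) y hyC
    have hpO : ∀ t, p t ∈ O := fun t ↦ connectedComponentIn_subset _ _ (hp t)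
    -- the folded path avoids `Λ`
    have hfold : ∀ t, foldUp (p t) ∉ Λ := by
      intro t h
      rcases foldUp_eq_or (p t) with h' | h'
      · exact hpO t (Or.inl (h' ▸ h))
      · refine hpO t (Or.inr ⟨foldUp (p t), h, ?_⟩)
        rw [h', Complex.conj_conj]
    -- hence stays at positive distance from `Λ`
    set K : Set ℂ := range (foldUp ∘ p) with hK
    have hKc : IsCompact K := isCompact_range (continuous_foldUp.comp p.continuous)
    have hKΛ : K ⊆ Λᶜ := by
      rintro _ ⟨t, rfl⟩
      exact hfold t
    obtain ⟨δ, hδ, hδK⟩ := hKc.exists_thickening_subset_open hΛc.isClosed.isOpen_compl hKΛ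
    -- balls around the endpoints inside `M`
    obtain ⟨ρx, hρx, hρxM⟩ := Metric.isOpen_iff.1 hMopen x hx
    obtain ⟨ρy, hρy, hρyM⟩ := Metric.isOpen_iff.1 hMopen y hy
    -- the lift
    set η : ℝ := min (δ / 2) (min (ρx / 2) (ρy / 2)) with hη
    have hη0 : 0 < η := by positivity
    have hηδ : η < δ := (min_le_left _ _).trans_lt (half_lt_self hδ)
    have hηx : η < ρx := ((min_le_right _ _).trans (min_le_left _ _)).trans_lt (half_lt_self hρx)
    have hηy : η < ρy := ((min_le_right _ _).trans (min_le_right _ _)).trans_lt (half_lt_self hρy)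
    have hshift : ∀ z : ℂ, dist (z + η * I) z = η := fun z ↦ by
      rw [dist_eq_norm, add_sub_cancel_left, norm_mul, Complex.norm_real, Complex.norm_I, mul_one,
        Real.norm_eq_abs, abs_of_pos hη0]
    -- (1) `x` to `x + iη` inside the ball
    have h1 : JoinedIn M x (x + η * I) := by
      refine JoinedIn.of_segment_subset (((convex_ball x ρx).segment_subset ?_ ?_).trans hρxM)
      · exact mem_ball_self hρx
      · rw [mem_ball, hshift]
        exact hηx
    -- (3) `y + iη` to `y`
    have h3 : JoinedIn M (y + η * I) y := by
      refine JoinedIn.of_segment_subset (((convex_ball y ρy).segment_subset ?_ ?_).trans hρyM)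
      · rw [mem_ball, hshift]
        exact hηy
      · exact mem_ball_self hρy
    -- (2) the lifted folded path
    have h2 : JoinedIn M (x + η * I) (y + η * I) := by
      let q : Path (x + η * I) (y + η * I) :=
        { toFun := fun t ↦ foldUp (p t) + η * I
          continuous_toFun := (continuous_foldUp.comp p.continuous).add continuous_const
          source' := by simp [foldUp_of_nonneg hxim.le]
          target' := by simp [foldUp_of_nonneg hyim.le] }
      refine ⟨q, fun t ↦ ⟨?_, ?_⟩⟩
      · show 0 < (foldUp (p t) + η * I).im
        simp only [Complex.add_im, foldUp_im, Complex.mul_im, Complex.ofReal_re, Complex.I_im,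
          mul_one, Complex.ofReal_im, Complex.I_re, mul_zero, add_zero]
        positivity
      · show foldUp (p t) + η * I ∉ Λ
        intro hmem
        have : foldUp (p t) + ↑η * I ∈ thickening δ K :=
          Metric.mem_thickening_iff.2 ⟨foldUp (p t), ⟨t, rfl⟩, by rw [hshift]; exact hηδ⟩
        exact hδK this hmem
    exact (h1.trans h2).trans h3
  -- a point of `M`: high on the imaginary axis
  obtain ⟨R, hR⟩ := hΛc.isBounded.subset_closedBall 0
  have hz₀ : ((|R| + 1 : ℝ) : ℂ) * I ∈ M := by
    refine ⟨?_, fun h ↦ ?_⟩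
    · show 0 < ((((|R| + 1 : ℝ) : ℂ)) * I).im
      simp only [Complex.mul_im, Complex.ofReal_re, Complex.I_im, mul_one, Complex.ofReal_im,
        Complex.I_re, mul_zero, add_zero]
      positivity
    · have := hR h
      rw [mem_closedBall, dist_zero_right, norm_mul, Complex.norm_real, Complex.norm_I, mul_one,
        Real.norm_eq_abs, abs_of_pos (by positivity)] at this
      linarith [le_abs_self R]
  exact IsPathConnected.isConnected ⟨_, hz₀, fun y hy ↦ hjoin _ hz₀ y hy⟩

end Arc

/-! ### Simple traces -/

/-- The inclusion `unitInterval.toNNReal : [0, 1] → ℝ≥0` (Mathlib) is injective. [folklore] -/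
theorem unitInterval.toNNReal_injective : Function.Injective unitInterval.toNNReal :=
  fun _ _ h ↦ Subtype.ext (congrArg (fun u : ℝ≥0 ↦ (u : ℝ)) h)

/-- **The open upper half-plane minus an initial segment of a simple trace is connected**: for
`γ : ℝ≥0 → ℂ` continuous and injective with `γ 0` real and `γ s ∈ ℍ` for `s > 0`, every
`ℍ ∖ γ[0, t]` is connected (`t = 0`: `ℍ` itself; `t > 0`: `γ[0, t]` is a Jordan arc hanging
from `γ 0`). [folklore] -/
theorem isConnected_upperHalfPlaneSet_diff_image {γ : ℝ≥0 → ℂ} (hγ : Continuous γ)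
    (hinj : Function.Injective γ) (h0 : (γ 0).im = 0) (hpos : ∀ s, 0 < s → 0 < (γ s).im)
    (t : ℝ≥0) : IsConnected (upperHalfPlaneSet \ γ '' Icc 0 t) := by
  rcases eq_or_ne t 0 with rfl | ht
  · -- `γ[0, 0] = {γ 0}` misses `ℍ`
    have h : upperHalfPlaneSet \ γ '' Icc (0 : ℝ≥0) 0 = upperHalfPlaneSet := by
      rw [Icc_self, image_singleton, sdiff_eq_left, disjoint_singleton_right]
      intro hmem
      exact absurd h0 (ne_of_gt hmem)
    rw [h]
    exact ((convex_halfSpace_im_gt 0).isPathConnected ⟨Complex.I, by simp⟩).isConnected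
  · -- parametrise `γ[0, t]` by `[0, 1]`
    have ht0 : 0 < t := pos_iff_ne_zero.2 ht
    have hmem : ∀ s : unitInterval, γ (unitInterval.toNNReal s * t) ∈ γ '' Icc 0 t := fun s ↦
      mem_image_of_mem _ ⟨bot_le, by
        rw [← NNReal.coe_le_coe, NNReal.coe_mul, unitInterval.coe_toNNReal]
        exact mul_le_of_le_one_left t.2 s.2.2⟩
    set f : unitInterval → γ '' Icc 0 t := fun s ↦ ⟨γ (unitInterval.toNNReal s * t), hmem s⟩
      with hf
    have hfc : Continuous f :=
      continuous_induced_rng.2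
        (hγ.comp (unitInterval.toNNReal_continuous.mul continuous_const))
    have hfinj : Function.Injective f := fun s s' h ↦
      unitInterval.toNNReal_injective
        (mul_right_cancel₀ ht (hinj (congrArg Subtype.val h)))
    have hfsurj : Function.Surjective f := by
      rintro ⟨_, ⟨u, hu, rfl⟩⟩
      have hut : (u : ℝ) / t ≤ 1 := by
        rw [div_le_one (by exact_mod_cast ht0)]
        exact_mod_cast hu.2
      refine ⟨⟨(u : ℝ) / t, div_nonneg u.2 t.2, hut⟩, Subtype.ext ?_⟩
      show γ (unitInterval.toNNReal ⟨(u : ℝ) / t, _⟩ * t) = γ u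
      congr 1
      ext
      rw [NNReal.coe_mul, unitInterval.coe_toNNReal]
      exact div_mul_cancel₀ _ (by exact_mod_cast ht)
    let e : unitInterval ≃ₜ γ '' Icc 0 t :=
      Continuous.homeoOfEquivCompactToT2 (f := Equiv.ofBijective f ⟨hfinj, hfsurj⟩) hfc
    refine isConnected_upperHalfPlaneSet_diff_arc e ?_ fun s hs ↦ ?_
    · show (γ (unitInterval.toNNReal 0 * t)).im = 0
      rw [unitInterval.toNNReal_zero, zero_mul, h0]
    · show 0 < (γ (unitInterval.toNNReal s * t)).im
      refine hpos _ (mul_pos ?_ ht0)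
      have hs' : (0 : ℝ) < s := lt_of_le_of_ne s.2.1 (fun h ↦ hs (Subtype.ext h.symm))
      exact_mod_cast hs'

end Literature.Topology.PlaneTopology

end
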